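import Literature.NumberTheory.ModularForms.PoincareSeriesWeightTwoHeckeUnfolding
import Literature.NumberTheory.ModularForms.PoincareSeriesWeightTwoHeckeLimitLemmas
import Literature.NumberTheory.ModularForms.PoincareSeriesWeightTwoCuspFormSqIntegrable
import Literature.NumberTheory.ModularForms.PoincareSeriesWeightTwoQSeriesHolomorphic
import Mathlib.NumberTheory.ModularForms.QExpansion
import Mathlib.MeasureTheory.Constructions.BorelSpace.Metrizable
import HarnessLib

/-!
# The weight-2 Poincaré cusp form of `Γ₀(N)`: assembly of the Hecke–Selberg `L²` line (proofs only)

Topic `Literature/NumberTheory/ModularForms` (namespace `Literature.NumberTheory.ModularForms.PoincareWeightTwo`).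
THEOREMS ONLY: stub T7 (`stub_poincareAssembly`) of the fact skeleton I1 `poincare-hecke` for
`kowalskiMichel2000_peterssonFormula` (crux item stmt-Parity-20404). From the five analytic inputs of
the line — T1 (convergence + weight-`(2,s)` automorphy of `P_m(·,s)`), T3 (pointwise Hecke limit
`P_m(·,s) → Q_m := Σ p_m(n) e(nz)`), U (unfolding `⟨yˢP_m(·,s), f⟩ = Γ(s+1)(4πm)^{−s−1} a_f(m)`),
T4 (`yˢP_m(·,s) → Q_m` in the weight-2 `L²` norm) and T5 (an `L²` holomorphic weight-2 invariant
function is a cusp form) — it assembles Iwaniec–Kowalski's Lemmas 14.2–14.3 at `k = 2`: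
**there is `P ∈ S_2(Γ₀(N))` with `a_P(n) = p_m(n)` (`n ≥ 1`) and `⟨P, f⟩ = a_f(m)/(4πm)` for all `f`.**

Steps: `Q_m` is holomorphic (`mdifferentiable_poincareQSeries`), weight-2 invariant (T1 + T3,
`poincareLimit_smul`) and square-integrable (T4), so T5 gives the cusp form `P` with `⇑P = Q_m`; its
coefficients are `p_m(n)` by `q`-expansion uniqueness (Mathlib `ModularFormClass.qExpansion_coeff_unique`);
and `⟨P, f⟩ = ⟨Q_m, f⟩ = lim_{s→0⁺} ⟨yˢP_m(·,s), f⟩ = lim Γ(s+1)(4πm)^{−s−1}a_f(m) = a_f(m)/(4πm)`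
(Cauchy–Schwarz `norm_peterssonPairing_le` with T4; `tendsto_Gamma_div_rpow`). The two small analytic
facts proved here for that: `P_m(·,s)` is measurable (`s > 0`; limit of finite row sums), and the
Petersson pairing is additive in its first slot on square-integrable measurable functions.

* `poincareAssembly` — the implication `T1 → T3 → U → T4 → T5 → PoincareExists` with the bodies of the
  skeleton's Props spelled out (so that `stub_poincareAssembly := poincareAssembly`).

Cell `landau-siegel` / `ls-inputs` (D-0154 (2)), seat `ls-inputs-I1-w2`. «The programme SEARCHES and
TYPES; no claim about Landau–Siegel zeros, Theorems 1–2 of arXiv:2211.02515 or a repaired Margin232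
until a kernel theorem says so.»

## References

* [IwaniecKowalski2004] H. Iwaniec, E. Kowalski, *Analytic Number Theory*, Lemma 14.2, Lemma 14.3,
  Prop. 14.5 (k = 2 by Hecke's trick, §3.2); (14.11) (Petersson norm).
-/

noncomputable section

open scoped MatrixGroups Real ModularForm ComplexConjugate NNReal ENNReal Topology Manifold
open CongruenceSubgroup Complex MeasureTheory Set Filter
open UpperHalfPlane hiding I
open Literature.NumberTheory.EllipticCurves.ModularForms

namespace Literature.NumberTheory.ModularForms.PoincareWeightTwo

variable {N : ℕ} [NeZero N]

/-! ### Measurability of `P_m(·, s)` -/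

omit [NeZero N] in
/-- Each term of the Hecke-regularised Poincaré series is a measurable function of `z`.
[cite: IwaniecKowalski2004, §14.1 (14.4)] -/
theorem measurable_poincareTerm (m : ℕ) (s : ℝ) (v : Row N) :
    Measurable fun z : ℍ ↦ poincareTerm N m s v z := by
  have hrd : Measurable fun z : ℍ ↦ rowDenom v.1 z := by
    unfold rowDenom
    exact (measurable_const.mul UpperHalfPlane.continuous_coe.measurable).add measurable_const
  unfold poincareTerm
  refine ((hrd.pow_const 2).inv.mul (Complex.measurable_ofReal.comp (hrd.norm.pow_const _))).mul ?_
  exact Complex.measurable_exp.comp (measurable_const.mul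
    (UpperHalfPlane.continuous_coe.measurable.comp (continuous_sl2z_smul _).measurable))

omit [NeZero N] in
/-- **`P_m(·, s)` is measurable for `s > 0`** (pointwise limit of the finite row sums along the
countably generated filter `atTop` on `Finset (Row N)`). [cite: IwaniecKowalski2004, §14.1 (14.4)] -/
theorem measurable_poincareHecke (m : ℕ) {s : ℝ} (hs : 0 < s) :
    Measurable (poincareHecke N m s) := by
  have hlim : Tendsto (fun S : Finset (Row N) ↦ fun z : ℍ ↦ ∑ v ∈ S, poincareTerm N m s v z) atTop
      (𝓝 (fun z : ℍ ↦ ∑' v : Row N, poincareTerm N m s v z)) :=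
    tendsto_pi_nhds.mpr fun z ↦ (summable_poincareTerm m hs z).hasSum
  have hmeas : Measurable (fun z : ℍ ↦ ∑' v : Row N, poincareTerm N m s v z) :=
    measurable_of_tendsto_metrizable' atTop
      (fun S ↦ Finset.measurable_sum S fun v _ ↦ measurable_poincareTerm m s v) hlim
  have : poincareHecke N m s = fun z : ℍ ↦ (1 / 2 : ℂ) * ∑' v : Row N, poincareTerm N m s v z := by
    funext z; rfl
  rw [this]
  exact measurable_const.mul hmeas

/-! ### The Petersson pairing: integrability from square-integrability, additivity in the first slot -/

/-- For measurable square-integrable `g₁, g₂` the Petersson integrand `Σ_q conj(g₁) g₂ yᵏ (q⁻¹τ)` is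
integrable on the standard fundamental domain (`|ab| ≤ (|a|² + |b|²)/2` termwise).
[cite: IwaniecKowalski2004, (14.11)] -/
theorem integrableOn_sum_petersson {k : ℤ} (g₁ g₂ : ℍ → ℂ) (hg₁ : Measurable g₁) (hg₂ : Measurable g₂)
    (h₁ : PeterssonSqIntegrable N k g₁) (h₂ : PeterssonSqIntegrable N k g₂) :
    letI := Fintype.ofFinite (𝒮ℒ ⧸ (Gamma0 N : Subgroup (GL (Fin 2) ℝ)).subgroupOf 𝒮ℒ)
    IntegrableOn (fun τ : ℍ ↦ ∑ q : 𝒮ℒ ⧸ (Gamma0 N : Subgroup (GL (Fin 2) ℝ)).subgroupOf 𝒮ℒ,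
      petersson k g₁ g₂ (((q.out : 𝒮ℒ) : GL (Fin 2) ℝ)⁻¹ • τ)) ModularGroup.fd volume := by
  letI := Fintype.ofFinite (𝒮ℒ ⧸ (Gamma0 N : Subgroup (GL (Fin 2) ℝ)).subgroupOf 𝒮ℒ)
  have hA : IntegrableOn _ ModularGroup.fd volume := h₁
  have hB : IntegrableOn _ ModularGroup.fd volume := h₂
  refine Integrable.mono' ((hA.add hB).div_const 2) ?_ (ae_of_all _ fun τ ↦ ?_)
  · refine (Finset.measurable_sum _ fun q _ ↦ ?_).aestronglyMeasurable
    have hsm : Measurable fun τ : ℍ ↦ (((q.out : 𝒮ℒ) : GL (Fin 2) ℝ)⁻¹ • τ) :=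
      (continuous_const_smul _).measurable
    unfold petersson
    exact ((Complex.continuous_conj.measurable.comp (hg₁.comp hsm)).mul (hg₂.comp hsm)).mul
      ((Complex.measurable_ofReal.comp (UpperHalfPlane.continuous_im.measurable.comp hsm)).pow_const _)
  · refine (norm_sum_le _ _).trans ?_
    simp only [Pi.add_apply]
    rw [← Finset.sum_add_distrib, Finset.sum_div]
    refine Finset.sum_le_sum fun q _ ↦ ?_
    rw [norm_petersson]
    set a := ‖g₁ (((q.out : 𝒮ℒ) : GL (Fin 2) ℝ)⁻¹ • τ)‖
    set b := ‖g₂ (((q.out : 𝒮ℒ) : GL (Fin 2) ℝ)⁻¹ • τ)‖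
    set Y := ((((q.out : 𝒮ℒ) : GL (Fin 2) ℝ)⁻¹ • τ).im) ^ k
    have hy : 0 < Y := zpow_pos (UpperHalfPlane.im_pos _) k
    nlinarith [mul_nonneg (sq_nonneg (a - b)) hy.le]

/-- **Additivity of the Petersson pairing in the first slot** (on integrable integrands):
`⟨g₁ − g₁', g₂⟩ = ⟨g₁, g₂⟩ − ⟨g₁', g₂⟩`. [cite: IwaniecKowalski2004, (14.11)] -/
theorem peterssonPairing_sub_left {k : ℤ} (g₁ g₁' g₂ : ℍ → ℂ)
    (h₁ : letI := Fintype.ofFinite (𝒮ℒ ⧸ (Gamma0 N : Subgroup (GL (Fin 2) ℝ)).subgroupOf 𝒮ℒ)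
      IntegrableOn (fun τ : ℍ ↦ ∑ q : 𝒮ℒ ⧸ (Gamma0 N : Subgroup (GL (Fin 2) ℝ)).subgroupOf 𝒮ℒ,
        petersson k g₁ g₂ (((q.out : 𝒮ℒ) : GL (Fin 2) ℝ)⁻¹ • τ)) ModularGroup.fd volume)
    (h₁' : letI := Fintype.ofFinite (𝒮ℒ ⧸ (Gamma0 N : Subgroup (GL (Fin 2) ℝ)).subgroupOf 𝒮ℒ)
      IntegrableOn (fun τ : ℍ ↦ ∑ q : 𝒮ℒ ⧸ (Gamma0 N : Subgroup (GL (Fin 2) ℝ)).subgroupOf 𝒮ℒ,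
        petersson k g₁' g₂ (((q.out : 𝒮ℒ) : GL (Fin 2) ℝ)⁻¹ • τ)) ModularGroup.fd volume) :
    peterssonPairing N k (fun z ↦ g₁ z - g₁' z) g₂ = peterssonPairing N k g₁ g₂ - peterssonPairing N k g₁' g₂ := by
  letI := Fintype.ofFinite (𝒮ℒ ⧸ (Gamma0 N : Subgroup (GL (Fin 2) ℝ)).subgroupOf 𝒮ℒ)
  unfold peterssonPairing
  rw [← integral_sub h₁ h₁']
  refine setIntegral_congr_fun ModularGroup.isClosed_fd.measurableSet fun τ _ ↦ ?_
  rw [← Finset.sum_sub_distrib]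
  refine Finset.sum_congr rfl fun q _ ↦ ?_
  simp only [petersson, map_sub]
  ring

/-- The difference of two measurable square-integrable functions is square-integrable
(`|a − b|² ≤ 2|a|² + 2|b|²`). [cite: IwaniecKowalski2004, (14.11)] -/
theorem peterssonSqIntegrable_sub {k : ℤ} (g₁ g₂ : ℍ → ℂ) (hg₁ : Measurable g₁) (hg₂ : Measurable g₂)
    (h₁ : PeterssonSqIntegrable N k g₁) (h₂ : PeterssonSqIntegrable N k g₂) :
    PeterssonSqIntegrable N k (fun z ↦ g₁ z - g₂ z) := by
  letI := Fintype.ofFinite (𝒮ℒ ⧸ (Gamma0 N : Subgroup (GL (Fin 2) ℝ)).subgroupOf 𝒮ℒ)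
  have hA : IntegrableOn _ ModularGroup.fd volume := h₁
  have hB : IntegrableOn _ ModularGroup.fd volume := h₂
  unfold PeterssonSqIntegrable
  refine Integrable.mono' ((hA.add hB).const_mul 2) ?_ (ae_of_all _ fun τ ↦ ?_)
  · refine (Finset.measurable_sum _ fun q _ ↦ ?_).aestronglyMeasurable
    have hsm : Measurable fun τ : ℍ ↦ (((q.out : 𝒮ℒ) : GL (Fin 2) ℝ)⁻¹ • τ) :=
      (continuous_const_smul _).measurable
    exact (((hg₁.comp hsm).sub (hg₂.comp hsm)).norm.pow_const 2).mul
      ((UpperHalfPlane.continuous_im.measurable.comp hsm).pow_const _)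
  · rw [Real.norm_of_nonneg (Finset.sum_nonneg fun q _ ↦
      mul_nonneg (sq_nonneg _) (zpow_pos (UpperHalfPlane.im_pos _) k).le)]
    simp only [Pi.add_apply]
    rw [← Finset.sum_add_distrib, Finset.mul_sum]
    refine Finset.sum_le_sum fun q _ ↦ ?_
    have hy : 0 < ((((q.out : 𝒮ℒ) : GL (Fin 2) ℝ)⁻¹ • τ).im) ^ k := zpow_pos (UpperHalfPlane.im_pos _) k
    have hab : ‖g₁ (((q.out : 𝒮ℒ) : GL (Fin 2) ℝ)⁻¹ • τ) - g₂ (((q.out : 𝒮ℒ) : GL (Fin 2) ℝ)⁻¹ • τ)‖ ^ 2 ≤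
        2 * (‖g₁ (((q.out : 𝒮ℒ) : GL (Fin 2) ℝ)⁻¹ • τ)‖ ^ 2 + ‖g₂ (((q.out : 𝒮ℒ) : GL (Fin 2) ℝ)⁻¹ • τ)‖ ^ 2) := by
      have h := norm_sub_le (g₁ (((q.out : 𝒮ℒ) : GL (Fin 2) ℝ)⁻¹ • τ)) (g₂ (((q.out : 𝒮ℒ) : GL (Fin 2) ℝ)⁻¹ • τ))
      nlinarith [h, norm_nonneg (g₁ (((q.out : 𝒮ℒ) : GL (Fin 2) ℝ)⁻¹ • τ) - g₂ (((q.out : 𝒮ℒ) : GL (Fin 2) ℝ)⁻¹ • τ)),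
        sq_nonneg (‖g₁ (((q.out : 𝒮ℒ) : GL (Fin 2) ℝ)⁻¹ • τ)‖ - ‖g₂ (((q.out : 𝒮ℒ) : GL (Fin 2) ℝ)⁻¹ • τ)‖)]
    nlinarith [hab, hy]

/-! ### `q`-series with polynomially bounded coefficients converge on `ℍ` -/

omit [NeZero N] in
/-- A `q`-series `Σ aₙ e(z)ⁿ` with `|aₙ| ≤ C (n+1)ᵏ` converges at every `z ∈ ℍ`. [folklore] -/
private theorem summable_qSeries {a : ℕ → ℂ} {C : ℝ} {k : ℕ} (ha : ∀ n, ‖a n‖ ≤ C * ((n : ℝ) + 1) ^ k)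
    (τ : ℍ) : Summable fun n ↦ a n * cexp (2 * π * Complex.I * τ) ^ n := by
  set r : ℝ := ‖cexp (2 * π * Complex.I * τ)‖ with hr
  have hrpos : 0 < r := norm_pos_iff.mpr (Complex.exp_ne_zero _)
  have hr1 : r < 1 := by
    rw [hr, Complex.norm_exp]
    refine Real.exp_lt_one_iff.mpr ?_
    have : (2 * π * Complex.I * τ).re = -2 * π * τ.im := by
      simp [Complex.mul_re, Complex.mul_im]
    rw [this]
    nlinarith [Real.pi_pos, τ.im_pos]
  have h1 : Summable fun n : ℕ ↦ ((n : ℝ)) ^ k * r ^ n :=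
    summable_pow_mul_geometric_of_norm_lt_one k (by rwa [Real.norm_of_nonneg hrpos.le])
  have h2 := (summable_nat_add_iff 1).mpr h1
  have hM : Summable fun n : ℕ ↦ C * ((n : ℝ) + 1) ^ k * r ^ n := by
    refine ((h2.mul_left (C * r⁻¹))).congr fun n ↦ ?_
    simp only [Nat.cast_add, Nat.cast_one, pow_succ]
    field_simp
  refine Summable.of_norm_bounded hM fun n ↦ ?_
  rw [norm_mul, norm_pow]
  exact mul_le_mul_of_nonneg_right (ha n) (pow_nonneg hrpos.le n)

/-! ### The assembly -/

/-- **Stub T7 of the I1 fact skeleton `poincare-hecke` (`stub_poincareAssembly`), the implication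
`T1 → T3 → U → T4 → T5 → PoincareExists` with the bodies of the skeleton's Props verbatim:** from
convergence + weight-`(2,s)` automorphy of `P_m(·,s)` (T1), the pointwise Hecke limit `P_m(·,s) → Q_m`
(T3), the unfolding identity (U), the `L²` limit (T4) and the `L²`-holomorphic ⇒ cusp form principle
(T5), **there is `P ∈ S_2(Γ₀(N))` with `a_P(n) = p_m(n)` for `n ≥ 1` and `⟨P, f⟩ = a_f(m)/(4πm)` for every
`f ∈ S_2(Γ₀(N))`** (Iwaniec–Kowalski Lemmas 14.2–14.3 at `k = 2`). [cite: IwaniecKowalski2004, Lemma 14.2 and Lemma 14.3 (k = 2, Hecke's trick §3.2)] -/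
theorem poincareAssembly
    (hT1 : ∀ (N : ℕ) [NeZero N] (m : ℕ), 1 ≤ m → ∀ (s : ℝ), 0 < s → ∀ z : ℍ,
      Summable (fun v : Row N ↦ poincareTerm N m s v z) ∧
      ∀ γ : SL(2, ℤ), γ ∈ Gamma0 N →
        poincareHecke N m s (γ • z) =
          (rowDenom ((γ : Matrix (Fin 2) (Fin 2) ℤ) 1) z) ^ 2 *
            ((‖rowDenom ((γ : Matrix (Fin 2) (Fin 2) ℤ) 1) z‖ ^ (2 * s) : ℝ) : ℂ) *
              poincareHecke N m s z)
    (hT3 : ∀ (N : ℕ) [NeZero N] (m : ℕ), 1 ≤ m → ∀ z : ℍ,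
      Tendsto (fun s : ℝ ↦ poincareHecke N m s z) (𝓝[>] 0) (𝓝 (poincareQSeries N m z)))
    (hU : ∀ (N : ℕ) [NeZero N] (m : ℕ), 1 ≤ m → ∀ (s : ℝ), 0 < s → ∀ f : CuspForm (Gamma0 N) 2,
      peterssonPairing N 2 (fun z : ℍ ↦ ((z.im ^ s : ℝ) : ℂ) * poincareHecke N m s z) ⇑f =
        ((Real.Gamma (s + 1) / (4 * π * m) ^ (s + 1) : ℝ) : ℂ) * cuspCoeff f m)
    (hT4 : ∀ (N : ℕ) [NeZero N] (m : ℕ), 1 ≤ m →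
      PeterssonSqIntegrable N 2 (poincareQSeries N m) ∧
      (∀ s : ℝ, 0 < s →
        PeterssonSqIntegrable N 2 (fun z : ℍ ↦ ((z.im ^ s : ℝ) : ℂ) * poincareHecke N m s z)) ∧
      Tendsto (fun s : ℝ ↦ (peterssonPairing N 2
          (fun z : ℍ ↦ ((z.im ^ s : ℝ) : ℂ) * poincareHecke N m s z - poincareQSeries N m z)
          (fun z : ℍ ↦ ((z.im ^ s : ℝ) : ℂ) * poincareHecke N m s z - poincareQSeries N m z)).re)
        (𝓝[>] 0) (𝓝 0))
    (hT5 : ∀ (N : ℕ) [NeZero N] (g : ℍ → ℂ), MDifferentiable 𝓘(ℂ) 𝓘(ℂ) g →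
      (∀ γ : SL(2, ℤ), γ ∈ Gamma0 N → ∀ z : ℍ,
        g (γ • z) = (rowDenom ((γ : Matrix (Fin 2) (Fin 2) ℤ) 1) z) ^ 2 * g z) →
      PeterssonSqIntegrable N 2 g →
      ∃ f : CuspForm (Gamma0 N) 2, ∀ z : ℍ, f z = g z) :
    ∀ (N : ℕ) [NeZero N] (m : ℕ), 1 ≤ m → ∃ P : CuspForm (Gamma0 N) 2,
      (∀ n : ℕ, 1 ≤ n → cuspCoeff P n = poincareCoeff N m n) ∧
      (∀ f : CuspForm (Gamma0 N) 2,
        peterssonProduct (Gamma0 N) 2 P f = ((1 / (4 * π * m) : ℝ) : ℂ) * cuspCoeff f m) := by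
  intro N _ m hm
  -- the limit `Q = Σ p_m(n) e(nz)`: holomorphic, weight-2 invariant, square-integrable ⇒ a cusp form
  have hQmd : MDifferentiable 𝓘(ℂ) 𝓘(ℂ) (poincareQSeries N m) := mdifferentiable_poincareQSeries N hm
  have hQinv : ∀ γ : SL(2, ℤ), γ ∈ Gamma0 N → ∀ z : ℍ,
      poincareQSeries N m (γ • z) =
        (rowDenom ((γ : Matrix (Fin 2) (Fin 2) ℤ) 1) z) ^ 2 * poincareQSeries N m z :=
    fun γ hγ z ↦ poincareLimit_smul γ (fun s hs z ↦ (hT1 N m hm s hs z).2 γ hγ) (hT3 N m hm) z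
  obtain ⟨hQsq, hGsq, hL2⟩ := hT4 N m hm
  obtain ⟨P, hP⟩ := hT5 N (poincareQSeries N m) hQmd hQinv hQsq
  have hPQ : (⇑P : ℍ → ℂ) = poincareQSeries N m := funext hP
  refine ⟨P, fun n hn ↦ ?_, fun f ↦ ?_⟩
  · -- the coefficients, by uniqueness of the `q`-expansion
    have hΓ : (1 : ℝ) ∈ (Gamma0 N : Subgroup (GL (Fin 2) ℝ)).strictPeriods := by
      rw [strictPeriods_Gamma0]; exact AddSubgroup.mem_zmultiples 1
    obtain ⟨C, -, hC⟩ := norm_poincareCoeff_le_pow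
    have hsum : ∀ τ : ℍ, HasSum (fun n : ℕ ↦ (if n = 0 then (0 : ℂ) else poincareCoeff N m n) •
        Function.Periodic.qParam 1 (τ : ℂ) ^ n) (P τ) := by
      intro τ
      rw [hP τ, poincareQSeries_eq_qSeries]
      have hq : Function.Periodic.qParam 1 (τ : ℂ) = cexp (2 * π * Complex.I * τ) := by
        rw [Function.Periodic.qParam]; congr 1; push_cast; ring
      simp_rw [hq, smul_eq_mul]
      exact (summable_qSeries (fun n ↦ hC N m hm n) τ).hasSum
    have huniq := ModularFormClass.qExpansion_coeff_unique one_pos hΓ (f := P) hsum n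
    rw [cuspCoeff, ← huniq, if_neg (by omega)]
  · -- the reproducing property: `⟨P, f⟩ = lim_{s→0⁺} ⟨yˢP_m(·,s), f⟩ = a_f(m)/(4πm)`
    have hm0 : (0 : ℝ) < 4 * π * m := by
      have : (1 : ℝ) ≤ m := by exact_mod_cast hm
      positivity
    -- (i) the unfolding identity tends to `a_f(m)/(4πm)`
    have hlim1 : Tendsto (fun s : ℝ ↦ peterssonPairing N 2
        (fun z : ℍ ↦ ((z.im ^ s : ℝ) : ℂ) * poincareHecke N m s z) ⇑f) (𝓝[>] 0)
        (𝓝 (((1 / (4 * π * m) : ℝ) : ℂ) * cuspCoeff f m)) := by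
      have h := ((Complex.continuous_ofReal.tendsto _).comp (tendsto_Gamma_div_rpow hm)).mul
        (tendsto_const_nhds (x := cuspCoeff f m))
      refine h.congr' ?_
      filter_upwards [self_mem_nhdsWithin] with s hs
      exact (hU N m hm s hs f).symm
    -- (ii) the `L²` limit: `⟨yˢP_m(·,s), f⟩ → ⟨Q, f⟩` (Cauchy–Schwarz)
    have hQm : Measurable (poincareQSeries N m) := hQmd.continuous.measurable
    have hfm : Measurable (⇑f : ℍ → ℂ) := (ModularFormClass.holo f).continuous.measurable
    have hfsq : PeterssonSqIntegrable N 2 ⇑f := peterssonSqIntegrable_coe N 2 f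
    have hGm : ∀ s : ℝ, 0 < s →
        Measurable (fun z : ℍ ↦ ((z.im ^ s : ℝ) : ℂ) * poincareHecke N m s z) := fun s hs ↦
      (Complex.measurable_ofReal.comp (UpperHalfPlane.continuous_im.measurable.pow_const s)).mul
        (measurable_poincareHecke m hs)
    have hlim2 : Tendsto (fun s : ℝ ↦ peterssonPairing N 2
        (fun z : ℍ ↦ ((z.im ^ s : ℝ) : ℂ) * poincareHecke N m s z) ⇑f) (𝓝[>] 0)
        (𝓝 (peterssonPairing N 2 (poincareQSeries N m) ⇑f)) := by
      rw [← tendsto_sub_nhds_zero_iff]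
      refine squeeze_zero_norm' (a := fun s ↦ Real.sqrt ((peterssonPairing N 2
          (fun z : ℍ ↦ ((z.im ^ s : ℝ) : ℂ) * poincareHecke N m s z - poincareQSeries N m z)
          (fun z : ℍ ↦ ((z.im ^ s : ℝ) : ℂ) * poincareHecke N m s z - poincareQSeries N m z)).re) *
          Real.sqrt ((peterssonPairing N 2 ⇑f ⇑f).re)) ?_ ?_
      · filter_upwards [self_mem_nhdsWithin] with s hs
        rw [← peterssonPairing_sub_left _ _ _
          (integrableOn_sum_petersson _ _ (hGm s hs) hfm (hGsq s hs) hfsq)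
          (integrableOn_sum_petersson _ _ hQm hfm hQsq hfsq)]
        exact norm_peterssonPairing_le _ _
          (peterssonSqIntegrable_sub _ _ (hGm s hs) hQm (hGsq s hs) hQsq) hfsq
      · have h0 := (Real.continuous_sqrt.tendsto 0).comp hL2
        rw [Function.comp_def, Real.sqrt_zero] at h0
        simpa using h0.mul (tendsto_const_nhds (x := Real.sqrt ((peterssonPairing N 2 ⇑f ⇑f).re)))
    have heq : peterssonPairing N 2 (poincareQSeries N m) ⇑f = ((1 / (4 * π * m) : ℝ) : ℂ) * cuspCoeff f m :=
      tendsto_nhds_unique hlim2 hlim1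
    rw [← peterssonPairing_coe_eq, hPQ, heq]

end Literature.NumberTheory.ModularForms.PoincareWeightTwo

end
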